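import Summits.CriticalPhenomena.PercolationContinuityZ3.Theorems.PercNearOneGluingNoHeavyLowerTailSahiLatinCylinder

/-!
# `NoHeavyLowerTail` (crux stmt-CriticalPhenomena-4575), Sahi programme (prim-master-conj gen 45): RE-INDEXING THE AXES —
# the Latin kernel and the descent vocabulary are invariant under `ι ≃ ι'`, so the cylinder-partner theorems hold for a cylinder on ANY axis

Support file (`--supports stmt-CriticalPhenomena-4575`; toolkit).  Companion of `…SahiLatinCylinder` (which treats the axis `none` of `Option κ`).

* `ptCongr e : Pt ι ≃ Pt ι'` (`x ↦ x ∘ e.symm`), `reindex e s = s.map (ptCongr e)`; `kappa_reindex` (**`κ` is invariant**), and transport of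
  `IsUpperSet`, `AxisInessential` (axis `i ↦ e i`), `Indep`, `IsMaxOut`, `IsMinOf`, `C1`, `C2`, `AClosed`, `Terminal`, `MutAClosed`, `UpTriple`.
* `cylAt i = {x : x i ≠ 0}` (the threshold-1 cylinder on axis `i` of `[3]^ι`) and `reindex (axisEquiv i) (cylAt i) = cyl1` for
  `axisEquiv i : ι ≃ Option {j // j ≠ i}`.
* Consequences for every axis `i` of every finite index type (all FBP-free): **`kappa_cylAt_ne_zero_of_mutAClosed`** (TZ″ for a cylinder partner),
  **`indep_all_of_aclosed_zero_cylAt`** (TZ′ for the cylinder-member class), **`indep_all_of_terminal_zero_cylAt`** (TZ), `kappa_cylAt_nonneg`.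
Everything here is proved; axioms standard. [this work]
-/

namespace Summit.CriticalPhenomena.PercolationContinuityZ3.Theorems.SahiLatin

open Finset

variable {ι ι' : Type*}

/-! ## §1  Re-indexing points, sets and Latin triples (no finiteness needed) -/

/-- Re-indexing the axes of a point along `e : ι ≃ ι'`: `x ↦ x ∘ e.symm`. [this work] -/
def ptCongr (e : ι ≃ ι') : Pt ι ≃ Pt ι' := e.arrowCongr (Equiv.refl (Fin 3))

/-- Coordinates of a re-indexed point. [this work] -/
@[simp] theorem ptCongr_apply (e : ι ≃ ι') (x : Pt ι) (i' : ι') : ptCongr e x i' = x (e.symm i') := rfl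

/-- Coordinates of the inverse re-indexing. [this work] -/
@[simp] theorem ptCongr_symm_apply (e : ι ≃ ι') (y : Pt ι') (i : ι) : (ptCongr e).symm y i = y (e i) := rfl

/-- Re-indexing is an order isomorphism (forward). [this work] -/
theorem ptCongr_le_iff (e : ι ≃ ι') {x y : Pt ι} : ptCongr e x ≤ ptCongr e y ↔ x ≤ y := by
  constructor
  · intro h i; simpa using h (e i)
  · intro h i'; exact h (e.symm i')

/-- Re-indexing a finite set of points. [this work] -/
def reindex (e : ι ≃ ι') (s : Finset (Pt ι)) : Finset (Pt ι') := s.map (ptCongr e).toEmbedding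

/-- Membership in a re-indexed set. [this work] -/
@[simp] theorem mem_reindex {e : ι ≃ ι'} {s : Finset (Pt ι)} {y : Pt ι'} : y ∈ reindex e s ↔ (ptCongr e).symm y ∈ s := by
  rw [reindex, Finset.mem_map_equiv]

/-- Membership of a re-indexed point. [this work] -/
theorem ptCongr_mem_reindex {e : ι ≃ ι'} {s : Finset (Pt ι)} {x : Pt ι} : ptCongr e x ∈ reindex e s ↔ x ∈ s := by
  rw [mem_reindex, Equiv.symm_apply_apply]

/-- Re-indexing preserves nonemptiness. [this work] -/
theorem reindex_nonempty_iff (e : ι ≃ ι') {s : Finset (Pt ι)} : (reindex e s).Nonempty ↔ s.Nonempty := by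
  rw [reindex, Finset.map_nonempty]

/-- Re-indexed up-sets are up-sets. [this work] -/
theorem isUpperSet_reindex (e : ι ≃ ι') {s : Finset (Pt ι)} (hs : IsUpperSet (s : Set (Pt ι))) :
    IsUpperSet ((reindex e s : Finset (Pt ι')) : Set (Pt ι')) := by
  intro y z hyz hy
  rw [Finset.mem_coe, mem_reindex] at hy ⊢
  refine hs (fun i => ?_) hy
  simpa using hyz (e i)

/-- Re-indexing a Latin triple index. [this work] -/
def lpCongr (e : ι ≃ ι') : LPerm ι ≃ LPerm ι' := e.arrowCongr (Equiv.refl (Equiv.Perm (Fin 3)))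

/-- Points of a re-indexed Latin triple. [this work] -/
theorem lpt_lpCongr (e : ι ≃ ι') (ρ : LPerm ι) (j : Fin 3) : lpt (lpCongr e ρ) j = ptCongr e (lpt ρ j) := by
  funext i'; rfl

/-- Re-indexing `∅`. [this work] -/
@[simp] theorem reindex_empty (e : ι ≃ ι') : reindex e (∅ : Finset (Pt ι)) = ∅ := by
  ext y; simp

/-- Maximal non-elements transport. [this work] -/
theorem isMaxOut_reindex (e : ι ≃ ι') {s : Finset (Pt ι)} {m : Pt ι} : IsMaxOut (reindex e s) (ptCongr e m) ↔ IsMaxOut s m := by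
  constructor
  · rintro ⟨h1, h2⟩
    refine ⟨fun h => h1 (ptCongr_mem_reindex.2 h), fun y hmy hym => ?_⟩
    have := h2 (ptCongr e y) ((ptCongr_le_iff e).2 hmy) (fun h => hym ((ptCongr e).injective h))
    exact ptCongr_mem_reindex.1 this
  · rintro ⟨h1, h2⟩
    refine ⟨fun h => h1 (ptCongr_mem_reindex.1 h), fun y hmy hym => ?_⟩
    have hy : y = ptCongr e ((ptCongr e).symm y) := ((ptCongr e).apply_symm_apply y).symm
    rw [hy] at hmy hym ⊢
    rw [ptCongr_mem_reindex]
    exact h2 _ ((ptCongr_le_iff e).1 hmy) (fun h => hym (by rw [h]))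

/-- Minimal elements transport. [this work] -/
theorem isMinOf_reindex (e : ι ≃ ι') {s : Finset (Pt ι)} {m : Pt ι} : IsMinOf (reindex e s) (ptCongr e m) ↔ IsMinOf s m := by
  constructor
  · rintro ⟨h1, h2⟩
    refine ⟨ptCongr_mem_reindex.1 h1, fun y hy hym => ?_⟩
    have := h2 (ptCongr e y) (ptCongr_mem_reindex.2 hy) ((ptCongr_le_iff e).2 hym)
    exact (ptCongr e).injective this
  · rintro ⟨h1, h2⟩
    refine ⟨ptCongr_mem_reindex.2 h1, fun y hy hym => ?_⟩
    have hy' : y = ptCongr e ((ptCongr e).symm y) := ((ptCongr e).apply_symm_apply y).symm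
    rw [hy'] at hy hym ⊢
    rw [ptCongr_mem_reindex] at hy
    rw [h2 _ hy ((ptCongr_le_iff e).1 hym)]

/-- (C2) transports. [this work] -/
theorem c2_reindex (e : ι ≃ ι') {s t u : Finset (Pt ι)} : C2 (reindex e s) (reindex e t) (reindex e u) ↔ C2 s t u := by
  constructor
  · intro h m hm
    have := h (ptCongr e m) ((isMaxOut_reindex e).2 hm)
    exact ⟨ptCongr_mem_reindex.1 this.1, ptCongr_mem_reindex.1 this.2⟩
  · intro h y hy
    have hy' : y = ptCongr e ((ptCongr e).symm y) := ((ptCongr e).apply_symm_apply y).symm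
    rw [hy'] at hy ⊢
    have := h _ ((isMaxOut_reindex e).1 hy)
    exact ⟨ptCongr_mem_reindex.2 this.1, ptCongr_mem_reindex.2 this.2⟩

/-- (C1) transports. [this work] -/
theorem c1_reindex (e : ι ≃ ι') {s t u : Finset (Pt ι)} : C1 (reindex e s) (reindex e t) (reindex e u) ↔ C1 s t u := by
  constructor
  · intro h m hm hmtu
    exact h (ptCongr e m) ((isMinOf_reindex e).2 hm) ⟨ptCongr_mem_reindex.2 hmtu.1, ptCongr_mem_reindex.2 hmtu.2⟩
  · intro h y hy hytu
    have hy' : y = ptCongr e ((ptCongr e).symm y) := ((ptCongr e).apply_symm_apply y).symm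
    rw [hy'] at hy hytu
    exact h _ ((isMinOf_reindex e).1 hy) ⟨ptCongr_mem_reindex.1 hytu.1, ptCongr_mem_reindex.1 hytu.2⟩

/-- A-closedness transports. [this work] -/
theorem aclosed_reindex (e : ι ≃ ι') {a b c : Finset (Pt ι)} :
    AClosed (reindex e a) (reindex e b) (reindex e c) ↔ AClosed a b c :=
  ⟨fun h => ⟨(c2_reindex e).1 h.c2a, (c2_reindex e).1 h.c2b, (c2_reindex e).1 h.c2c⟩,
   fun h => ⟨(c2_reindex e).2 h.c2a, (c2_reindex e).2 h.c2b, (c2_reindex e).2 h.c2c⟩⟩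

/-- Terminality transports. [this work] -/
theorem terminal_reindex (e : ι ≃ ι') {a b c : Finset (Pt ι)} :
    Terminal (reindex e a) (reindex e b) (reindex e c) ↔ Terminal a b c :=
  ⟨fun h => ⟨(c1_reindex e).1 h.c1a, (c1_reindex e).1 h.c1b, (c1_reindex e).1 h.c1c,
      (c2_reindex e).1 h.c2a, (c2_reindex e).1 h.c2b, (c2_reindex e).1 h.c2c⟩,
   fun h => ⟨(c1_reindex e).2 h.c1a, (c1_reindex e).2 h.c1b, (c1_reindex e).2 h.c1c,
      (c2_reindex e).2 h.c2a, (c2_reindex e).2 h.c2b, (c2_reindex e).2 h.c2c⟩⟩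

/-- Mutual A-closedness transports. [this work] -/
theorem mutAClosed_reindex (e : ι ≃ ι') {b c : Finset (Pt ι)} :
    MutAClosed (reindex e b) (reindex e c) ↔ MutAClosed b c := by
  constructor
  · rintro ⟨h1, h2⟩
    exact ⟨fun m hm => ptCongr_mem_reindex.1 (h1 _ ((isMaxOut_reindex e).2 hm)),
      fun m hm => ptCongr_mem_reindex.1 (h2 _ ((isMaxOut_reindex e).2 hm))⟩
  · rintro ⟨h1, h2⟩
    refine ⟨fun y hy => ?_, fun y hy => ?_⟩
    · have hy' : y = ptCongr e ((ptCongr e).symm y) := ((ptCongr e).apply_symm_apply y).symm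
      rw [hy'] at hy ⊢
      exact ptCongr_mem_reindex.2 (h1 _ ((isMaxOut_reindex e).1 hy))
    · have hy' : y = ptCongr e ((ptCongr e).symm y) := ((ptCongr e).apply_symm_apply y).symm
      rw [hy'] at hy ⊢
      exact ptCongr_mem_reindex.2 (h2 _ ((isMaxOut_reindex e).1 hy))

/-- Up-triples transport (forward). [this work] -/
theorem upTriple_reindex (e : ι ≃ ι') {a b c : Finset (Pt ι)} (h : UpTriple a b c) :
    UpTriple (reindex e a) (reindex e b) (reindex e c) :=
  ⟨isUpperSet_reindex e h.1, isUpperSet_reindex e h.2.1, isUpperSet_reindex e h.2.2⟩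

section Dec

variable [DecidableEq ι] [DecidableEq ι']

/-! ## §2  Coordinate updates, axis-inessentiality, independence (decidable index types) -/

/-- Updating a coordinate commutes with re-indexing. [this work] -/
theorem ptCongr_update (e : ι ≃ ι') (x : Pt ι) (i : ι) (v : Fin 3) :
    ptCongr e (Function.update x i v) = Function.update (ptCongr e x) (e i) v := by
  funext i'
  simp only [ptCongr_apply]
  by_cases h : i' = e i
  · subst h; simp
  · rw [Function.update_of_ne h, Function.update_of_ne (fun h' => h (by rw [← h', Equiv.apply_symm_apply]))]
    rfl

/-- Axis-inessentiality transports along `i ↦ e i`. [this work] -/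
theorem axisInessential_reindex (e : ι ≃ ι') {s : Finset (Pt ι)} {i : ι} :
    AxisInessential (reindex e s) (e i) ↔ AxisInessential s i := by
  constructor
  · intro h x v
    have := h (ptCongr e x) v
    rwa [← ptCongr_update, ptCongr_mem_reindex, ptCongr_mem_reindex] at this
  · intro h y v
    have hy : y = ptCongr e ((ptCongr e).symm y) := ((ptCongr e).apply_symm_apply y).symm
    rw [hy, ← ptCongr_update, ptCongr_mem_reindex, ptCongr_mem_reindex]
    exact h _ v

/-- Independence transports. [this work] -/
theorem indep_reindex (e : ι ≃ ι') {s t : Finset (Pt ι)} : Indep (reindex e s) (reindex e t) ↔ Indep s t := by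
  constructor
  · intro h i
    rcases h (e i) with h1 | h1
    · exact Or.inl ((axisInessential_reindex e).1 h1)
    · exact Or.inr ((axisInessential_reindex e).1 h1)
  · intro h i'
    obtain ⟨i, rfl⟩ := e.surjective i'
    rcases h i with h1 | h1
    · exact Or.inl ((axisInessential_reindex e).2 h1)
    · exact Or.inr ((axisInessential_reindex e).2 h1)

end Dec

variable [Fintype ι] [DecidableEq ι] [Fintype ι'] [DecidableEq ι']

/-! ## §3  Indicators and the kernel (finite index types) -/

omit [DecidableEq ι] [DecidableEq ι'] in
/-- Indicators are preserved. [this work] -/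
theorem ind_reindex (e : ι ≃ ι') (s : Finset (Pt ι)) (x : Pt ι) : ind (reindex e s) (ptCongr e x) = ind s x := by
  by_cases h : x ∈ s
  · rw [ind_of_mem h, ind_of_mem (ptCongr_mem_reindex.2 h)]
  · rw [ind_of_not_mem h, ind_of_not_mem (fun h' => h (ptCongr_mem_reindex.1 h'))]

/-- Re-indexing `univ`. [this work] -/
@[simp] theorem reindex_univ (e : ι ≃ ι') : reindex e (univ : Finset (Pt ι)) = univ := by
  ext y; simp

/-- Re-indexing detects `univ`. [this work] -/
theorem reindex_eq_univ_iff (e : ι ≃ ι') {s : Finset (Pt ι)} : reindex e s = univ ↔ s = univ := by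
  constructor
  · intro h
    ext x
    simp only [mem_univ, iff_true]
    have : ptCongr e x ∈ reindex e s := by rw [h]; exact mem_univ _
    exact ptCongr_mem_reindex.1 this
  · rintro rfl; exact reindex_univ e

/-- **The Latin kernel is invariant under re-indexing the axes.** [this work] -/
theorem kappa_reindex (e : ι ≃ ι') (a b c : Finset (Pt ι)) :
    kappa (reindex e a) (reindex e b) (reindex e c) = kappa a b c := by
  unfold kappa
  rw [← (lpCongr e).sum_comp]
  refine Fintype.sum_congr _ _ fun ρ => ?_
  simp only [lpt_lpCongr, G, ind_reindex]



/-! ## §4  The threshold-1 cylinder on an arbitrary axis -/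

/-- The threshold-1 CYLINDER on axis `i`: `{x : x i ≠ 0}`. [this work] -/
def cylAt (i : ι) : Finset (Pt ι) := univ.filter fun x => x i ≠ 0

/-- Membership in `cylAt i`. [this work] -/
@[simp] theorem mem_cylAt {i : ι} {x : Pt ι} : x ∈ cylAt i ↔ x i ≠ 0 := by simp [cylAt]

/-- The equivalence sending the axis `i` to `none`. [this work] -/
def axisEquiv (i : ι) : ι ≃ Option {j // j ≠ i} := (Equiv.optionSubtypeNe i).symm

omit [Fintype ι] [Fintype ι'] [DecidableEq ι'] in
/-- `axisEquiv i i = none`. [this work] -/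
@[simp] theorem axisEquiv_self (i : ι) : axisEquiv i i = none := by
  simp [axisEquiv]

/-- Re-indexing along `axisEquiv i` sends `cylAt i` to `cyl1`. [this work] -/
theorem reindex_cylAt (i : ι) : reindex (axisEquiv i) (cylAt i) = cyl1 := by
  ext y
  rw [mem_reindex, mem_cylAt, mem_cyl1, ptCongr_symm_apply, axisEquiv_self]

/-- `cylAt i` is an up-set. [this work] -/
theorem isUpperSet_cylAt (i : ι) : IsUpperSet ((cylAt i : Finset (Pt ι)) : Set (Pt ι)) := by
  intro x y hxy hx
  rw [Finset.mem_coe, mem_cylAt] at hx ⊢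
  exact fin3_facts.1 _ _ hx (hxy i)

/-! ## §5  The cylinder-partner theorems on an arbitrary axis -/

/-- **FBP on the cylinder face, any axis** (up-sets `a, b`): `0 ≤ κ(a, b, {x_i ≥ 1})`. [this work] -/
theorem kappa_cylAt_nonneg (i : ι) {a b : Finset (Pt ι)} (ha : IsUpperSet (a : Set (Pt ι))) (hb : IsUpperSet (b : Set (Pt ι))) :
    0 ≤ kappa a b (cylAt i) := by
  rw [← kappa_reindex (axisEquiv i), reindex_cylAt]
  exact kappa_cyl1_nonneg (isUpperSet_reindex _ ha) (isUpperSet_reindex _ hb)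

/-- **TZ″ FOR A THRESHOLD-1 CYLINDER PARTNER ON ANY AXIS**: if the up-set `b` depends on axis `i`, `(b, {x_i ≥ 1})` is mutually A-closed and
`a` is a nonempty up-set, then `κ(a, b, {x_i ≥ 1}) ≠ 0`. [this work] -/
theorem kappa_cylAt_ne_zero_of_mutAClosed (i : ι) {a b : Finset (Pt ι)} (ha : IsUpperSet (a : Set (Pt ι)))
    (hb : IsUpperSet (b : Set (Pt ι))) (hane : a.Nonempty) (hdep : ¬ AxisInessential b i) (hM : MutAClosed b (cylAt i)) :
    kappa a b (cylAt i) ≠ 0 := by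
  rw [← kappa_reindex (axisEquiv i), reindex_cylAt]
  refine kappa_cyl1_ne_zero_of_mutAClosed (isUpperSet_reindex _ ha) (isUpperSet_reindex _ hb) ((reindex_nonempty_iff _).2 hane)
    (fun h => hdep ?_) ?_
  · rw [← axisEquiv_self i] at h
    exact (axisInessential_reindex (axisEquiv i)).1 h
  · rw [← reindex_cylAt i]
    exact (mutAClosed_reindex (axisEquiv i)).2 hM

/-- TZ″ (`MutAClosedZeroFree`) restricted to a `{x_i ≥ 1}` partner, any axis. [this work] -/
theorem mutAClosedZeroFree_cylAt (i : ι) (a b : Finset (Pt ι)) (hup : UpTriple a b (cylAt i)) (ha : a.Nonempty)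
    (hM : MutAClosed b (cylAt i)) (hI : ¬ Indep b (cylAt i)) : kappa a b (cylAt i) ≠ 0 := by
  refine kappa_cylAt_ne_zero_of_mutAClosed i hup.1 hup.2.1 ha (fun h => hI ?_) hM
  have h' : Indep (reindex (axisEquiv i) b) cyl1 := by
    refine indep_cyl1_of_axisInessential ?_
    rw [← axisEquiv_self i]
    exact (axisInessential_reindex (axisEquiv i)).2 h
  rw [← reindex_cylAt i] at h'
  exact (indep_reindex (axisEquiv i)).1 h'

/-- **TZ′ FOR THE CYLINDER-MEMBER CLASS, ANY AXIS**: an A-closed zero `(a, b, {x_i ≥ 1})` with `a` a nonempty up-set (and `b` an up-set)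
is pairwise independent. [this work] -/
theorem indep_all_of_aclosed_zero_cylAt (i : ι) {a b : Finset (Pt ι)} (hup : UpTriple a b (cylAt i)) (ha : a.Nonempty)
    (hA : AClosed a b (cylAt i)) (h0 : kappa a b (cylAt i) = 0) : Indep a b ∧ Indep a (cylAt i) ∧ Indep b (cylAt i) := by
  by_cases hI : Indep b (cylAt i)
  · exact indep_all_of_aclosed_zero_of_indepPair hup hA h0 (Or.inr (Or.inr hI))
  · exact absurd h0 (mutAClosedZeroFree_cylAt i a b hup ha hA.mutAClosed₂₃ hI)

/-- The same with the cylinder in the middle slot. [this work] -/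
theorem indep_all_of_aclosed_zero_cylAt₂ (i : ι) {a c : Finset (Pt ι)} (hup : UpTriple a (cylAt i) c) (ha : a.Nonempty)
    (hA : AClosed a (cylAt i) c) (h0 : kappa a (cylAt i) c = 0) : Indep a (cylAt i) ∧ Indep a c ∧ Indep (cylAt i) c := by
  have h0' : kappa a c (cylAt i) = 0 := by rw [kappa_swap23]; exact h0
  obtain ⟨h1, h2, h3⟩ := indep_all_of_aclosed_zero_cylAt i hup.swap23 ha hA.swap23 h0'
  exact ⟨h2, h1, h3.symm⟩

/-- The same with the cylinder in the first slot. [this work] -/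
theorem indep_all_of_aclosed_zero_cylAt₁ (i : ι) {b c : Finset (Pt ι)} (hup : UpTriple (cylAt i) b c) (hb : b.Nonempty)
    (hA : AClosed (cylAt i) b c) (h0 : kappa (cylAt i) b c = 0) : Indep (cylAt i) b ∧ Indep (cylAt i) c ∧ Indep b c := by
  have h0' : kappa b (cylAt i) c = 0 := by rw [kappa_swap12]; exact h0
  obtain ⟨h1, h2, h3⟩ := indep_all_of_aclosed_zero_cylAt₂ i hup.swap12 hb hA.swap12 h0'
  exact ⟨h1.symm, h3, h2⟩

/-- **TZ FOR THE CYLINDER-MEMBER CLASS, ANY AXIS**: a terminal zero `(a, b, {x_i ≥ 1})` with `a` nonempty is pairwise independent. [this work] -/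
theorem indep_all_of_terminal_zero_cylAt (i : ι) {a b : Finset (Pt ι)} (hup : UpTriple a b (cylAt i)) (ha : a.Nonempty)
    (hT : Terminal a b (cylAt i)) (h0 : kappa a b (cylAt i) = 0) : Indep a b ∧ Indep a (cylAt i) ∧ Indep b (cylAt i) :=
  indep_all_of_aclosed_zero_cylAt i hup ha hT.aclosed h0

end Summit.CriticalPhenomena.PercolationContinuityZ3.Theorems.SahiLatin
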